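import Mathlib
import Literature.NumberTheory.LFunctions.Zhang2022.Section17Eq173
import Literature.NumberTheory.LFunctions.Zhang2022.Section15Bcoef
import Literature.NumberTheory.LFunctions.Zhang2022.Section3Lemma34
import Literature.NumberTheory.Sieve.DivisorBound
import Literature.NumberTheory.LFunctions.Zhang2022.TypedSection13Edges
import HarnessLib

/-!
# Zhang (2022) §17: the divisor-type bound `|ν*(n)| ≤ Cn^{1/4}` on the coefficients of §17.u004,
# whence "the terms with `m ≠ n` are `o(p)`" and (17.3) follow from §17.u005 alone

Topic `Literature/NumberTheory/LFunctions/Zhang2022` (Landau–Siegel audit tree; verdict-neutral).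
Y. Zhang, *Discrete mean estimates and the Landau–Siegel zero*, arXiv:2211.02515v1 (2022)
[Zhang2022LandauSiegel] — **an unrefereed manuscript under adjudication**; nothing here asserts or
denies any of its claims. §17 p. 96 (tex L4719–L4728; DAG `Z22:§17.u004`, `Z22:§17.u005`,
`Z22:(17.3)` of the cell siegel-zhang): `ν*` is the `ψ`-coefficient sequence of
`(L(s+β₁,ψ)/L(s,ψ))B(s,ψ)G(s,ψ)N(s+β₂,ψ)N(s+β₃,ψ)`, typed (`Typed.Section17.nuStar`) as the Dirichlet
convolution `κ₂ ∗ (bχ) ∗ υ·[≤D⁴] ∗ nN_{β₂} ∗ nN_{β₃}`. This file PROVES the size bound the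
"trivial estimation" of (17.3) rests on:

* `norm_kappa₂_le_card_divisors` — `|κ₂(n)| ≤ τ₂(n)` (`κ₂ = n^{−iβ} ∗ μ`, both factors `≤ ζ`);
* `norm_nN_le_one` — `|n^{−β}g*(T²/n)| ≤ 1` for `β ∈ iℝ` (`0 ≤ g* < 1`);
* `norm_convolution_le_rpow` — `|u| ≤ An^a`, `|v| ≤ Bn^b` ⇒ `|u∗v|(n) ≤ AB·τ₂(n)·n^{a+b}
  ≤ AB·C_δ·n^{a+b+δ}` (divisor bound `τ₂(n) ≤ C_δn^δ`, tree `Sieve.exists_card_divisors_le_mul_rpow'`);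
* `nuStar_bound` — **`∃ C, ∀ large D, ∀ χ, ∀ n, |ν*(n)| ≤ C·n^{1/4}`** (`|b| ≤ (1+|ι₂|)(|ι₃|+|ι₄|)τ₂`
  is the tree's `Skeleton.norm_bcoef_le`, `|υ| ≤ τ₂` the tree's `Lemma34.norm_ups_le`; seven divisor
  bounds at `δ = 1/28`);
* `claim17_offdiag_holds : Claim17_offdiag c′` — the inline claim "the contribution from the terms
  with `m ≠ n` is `o(p)`" is a THEOREM (via `claim17_offdiag_of_nuStar_bound`, file `Section17Eq173`);
* `eq17_3_of_u005 : Step17_u005 c′ → Eq17_3 c′` — (17.3) from u005 ALONE (via `eq17_3_of`).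

So the DAG node `Z22:(17.3)` reduces to `Z22:§17.u005` (the contour shift `𝔍(1) → σ = 3/2` and the
term-by-term integration). WHAT THIS IS NOT: a proof of u005 or of (17.3) outright; any claim about
Theorems 1–2 of the source or about Landau–Siegel zeros; nothing here bears on the cell's verdict
on (8.24).

## References

* Y. Zhang, arXiv:2211.02515v1 (2022), §17 p. 96 (u004, u005, (17.3)); §15 (15.2); §3 (3.1).
  [cite: Zhang2022LandauSiegel, §17 (17.3)]
-/

noncomputable section

open Complex Real ComplexConjugate Finset
open Literature.NumberTheory.LFunctions.Zhang2022.Skeleton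
open Literature.NumberTheory.LFunctions.Zhang2022.Typed.Section17

namespace Literature.NumberTheory.LFunctions.Zhang2022.Phi3Eval

/-! ## §1. The factors -/

section Factors

/-- Termwise majorants multiply under Dirichlet convolution of arithmetic functions. [folklore] -/
private theorem norm_mul_apply_le' {f g : ArithmeticFunction ℂ} {F G : ArithmeticFunction ℝ}
    (hf : ∀ n, ‖f n‖ ≤ F n) (hg : ∀ n, ‖g n‖ ≤ G n) (n : ℕ) : ‖(f * g) n‖ ≤ (F * G) n := by
  rw [ArithmeticFunction.mul_apply, ArithmeticFunction.mul_apply]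
  refine (norm_sum_le _ _).trans (Finset.sum_le_sum fun x _ => ?_)
  rw [norm_mul]
  exact mul_le_mul (hf _) (hg _) (norm_nonneg _) ((norm_nonneg _).trans (hf _))

/-- `|n^{−ib}| ≤ ζ(n)`. [folklore] -/
private theorem norm_powI_le_zeta' (b : ℝ) (n : ℕ) :
    ‖MeanSquareMajorant.powI b n‖ ≤ (ArithmeticFunction.zeta : ArithmeticFunction ℝ) n := by
  rcases Nat.eq_zero_or_pos n with rfl | hn
  · simp
  · rw [MeanSquareMajorant.norm_powI_of_pos b hn, ArithmeticFunction.natCoe_apply,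
      ArithmeticFunction.zeta_apply_ne hn.ne']
    simp

/-- `|μ(n)| ≤ ζ(n)`. [folklore] -/
private theorem norm_moebius_le_zeta' (n : ℕ) :
    ‖(ArithmeticFunction.moebius : ArithmeticFunction ℂ) n‖ ≤
      (ArithmeticFunction.zeta : ArithmeticFunction ℝ) n := by
  rcases Nat.eq_zero_or_pos n with rfl | hn
  · simp
  · rw [ArithmeticFunction.intCoe_apply, ArithmeticFunction.natCoe_apply,
      ArithmeticFunction.zeta_apply_ne hn.ne', Complex.norm_intCast]
    exact_mod_cast ArithmeticFunction.abs_moebius_le_one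

/-- **`|κ₂(n)| ≤ τ₂(n)`** (`κ₂ = n^{−iβ₁} ∗ μ`, §16 p. 89: "`Σκ₂(n)n^{−s} = ζ(s+β₁)/ζ(s)`";
the tree's `MeanSquareMajorant.kappa₂`). [cite: Zhang2022LandauSiegel, §16 p.89] -/
theorem norm_kappa₂_le_card_divisors (b : ℝ) (n : ℕ) :
    ‖MeanSquareMajorant.kappa₂ b n‖ ≤ (n.divisors.card : ℝ) := by
  have h := norm_mul_apply_le' (norm_powI_le_zeta' b) norm_moebius_le_zeta' n
  rw [← MeanSquareMajorant.kappa₂] at h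
  refine h.trans (le_of_eq ?_)
  rw [← MeanSquareMajorant.tau_two_apply, MeanSquareMajorant.tau, pow_two]

/-- **`|n^{−β}g*(T²/n)| ≤ 1`** for a purely imaginary shift `β` (the `N(s+β,ψ)`-coefficients `nN`,
§6/§17: `|n^{−β}| = 1`, `0 ≤ g* < 1`; at `n = 0` both sides are degenerate and the bound still
holds). [cite: Zhang2022LandauSiegel, §17 u004 p.96] -/
theorem norm_nN_le_one {D : ℕ} (hℓ : 0 < ell D) {β : ℂ} (hβ : β.re = 0) (n : ℕ) :
    ‖nN D β n‖ ≤ 1 := by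
  rw [nN, norm_mul, Complex.norm_real]
  have hg : ‖gstar D (bigT D ^ 2 / n)‖ ≤ 1 := by
    rw [Real.norm_eq_abs, gstar]
    split_ifs
    · have h30 : 0 < ell D ^ 30 := by positivity
      rw [gW, abs_of_pos (GaussWeight.gWeight_pos h30 _)]
      exact (GaussWeight.gWeight_lt_one h30 _).le
    · simp
  have hp : ‖(n : ℂ) ^ (-β)‖ ≤ 1 := by
    rcases Nat.eq_zero_or_pos n with rfl | hn
    · rw [Nat.cast_zero]
      rcases eq_or_ne (-β) 0 with h | h
      · rw [h, Complex.cpow_zero, norm_one]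
      · rw [Complex.zero_cpow h, norm_zero]; exact zero_le_one
    · rw [Complex.norm_natCast_cpow_of_pos hn]; simp [hβ]
  calc ‖(n : ℂ) ^ (-β)‖ * ‖gstar D (bigT D ^ 2 / n)‖ ≤ 1 * 1 :=
        mul_le_mul hp hg (norm_nonneg _) zero_le_one
    _ = 1 := one_mul _

end Factors

/-! ## §2. Power majorants under Dirichlet convolution -/

section Conv

/-- **Power majorants convolve with a divisor-function loss**: if `|u(n)| ≤ An^a` and
`|v(n)| ≤ Bn^b` for `n ≥ 1` (`a, b ≥ 0`, `A ≥ 0`) and `τ₂(n) ≤ C_δ n^δ`, then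
`|(u∗v)(n)| ≤ ABC_δ·n^{a+b+δ}` for `n ≥ 1`. [folklore] -/
private theorem norm_convolution_le_rpow {u v : ℕ → ℂ} {A B a b Cd δ : ℝ} (ha : 0 ≤ a) (hb : 0 ≤ b)
    (hA : 0 ≤ A) (hu : ∀ n : ℕ, n ≠ 0 → ‖u n‖ ≤ A * (n : ℝ) ^ a)
    (hv : ∀ n : ℕ, n ≠ 0 → ‖v n‖ ≤ B * (n : ℝ) ^ b)
    (hCd : ∀ n : ℕ, (n.divisors.card : ℝ) ≤ Cd * (n : ℝ) ^ δ) (n : ℕ) (hn : n ≠ 0) :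
    ‖LSeries.convolution u v n‖ ≤ A * B * Cd * (n : ℝ) ^ (a + b + δ) := by
  have hn0 : (0 : ℝ) < n := by exact_mod_cast Nat.pos_of_ne_zero hn
  have hB : 0 ≤ B := by
    have := hv 1 one_ne_zero; simp at this; exact (norm_nonneg _).trans this
  rw [LSeries.convolution_def]
  -- each term is `≤ A B n^{a+b}`
  have hterm : ∀ x ∈ n.divisorsAntidiagonal, ‖u x.1 * v x.2‖ ≤ A * B * (n : ℝ) ^ (a + b) := by
    intro x hx
    obtain ⟨hmul, hne⟩ := Nat.mem_divisorsAntidiagonal.mp hx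
    have h1 : x.1 ≠ 0 := fun h => hne (by rw [← hmul, h, zero_mul])
    have h2 : x.2 ≠ 0 := fun h => hne (by rw [← hmul, h, mul_zero])
    have h1le : (x.1 : ℝ) ≤ n := by exact_mod_cast Nat.le_of_dvd (Nat.pos_of_ne_zero hn) ⟨x.2, hmul.symm⟩
    have h2le : (x.2 : ℝ) ≤ n := by
      exact_mod_cast Nat.le_of_dvd (Nat.pos_of_ne_zero hn) ⟨x.1, by rw [mul_comm]; exact hmul.symm⟩
    rw [norm_mul, Real.rpow_add hn0]
    calc ‖u x.1‖ * ‖v x.2‖ ≤ (A * (x.1 : ℝ) ^ a) * (B * (x.2 : ℝ) ^ b) :=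
          mul_le_mul (hu _ h1) (hv _ h2) (norm_nonneg _) ((norm_nonneg _).trans (hu _ h1))
      _ ≤ (A * (n : ℝ) ^ a) * (B * (n : ℝ) ^ b) := by
          gcongr
      _ = A * B * ((n : ℝ) ^ a * (n : ℝ) ^ b) := by ring
  calc ‖∑ x ∈ n.divisorsAntidiagonal, u x.1 * v x.2‖
      ≤ ∑ x ∈ n.divisorsAntidiagonal, A * B * (n : ℝ) ^ (a + b) :=
        (norm_sum_le _ _).trans (Finset.sum_le_sum hterm)
    _ = (n.divisorsAntidiagonal.card : ℝ) * (A * B * (n : ℝ) ^ (a + b)) := by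
        rw [Finset.sum_const, nsmul_eq_mul]
    _ = (n.divisors.card : ℝ) * (A * B * (n : ℝ) ^ (a + b)) := by
        rw [← Nat.map_div_right_divisors, Finset.card_map]
    _ ≤ Cd * (n : ℝ) ^ δ * (A * B * (n : ℝ) ^ (a + b)) :=
        mul_le_mul_of_nonneg_right (hCd n) (by positivity)
    _ = A * B * Cd * (n : ℝ) ^ (a + b + δ) := by
        rw [Real.rpow_add hn0 (a + b) δ]; ring

end Conv

/-! ## §3. The bound on `ν*` -/

section NuStar

/-- **`|ν*(n)| ≤ C·n^{1/4}` uniformly** (for `𝓛 = log D ≥ 2`, every `χ`, every `c′`, every `n`;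
`C = C_b·C_δ⁷` with `C_b = (1+|ι₂|)(|ι₃|+|ι₄|)` from (15.2) and `C_δ` the divisor-bound constant at
`δ = 1/28`): `ν* = κ₂ ∗ (bχ) ∗ υ·[≤D⁴] ∗ nN_{β₂} ∗ nN_{β₃}` with `|κ₂|, |bχ|/C_b, |υ| ≤ τ₂ ≤ C_δn^δ`,
`|nN| ≤ 1`, and four convolutions each costing `τ₂ ≤ C_δn^δ`: exponent `7δ = 1/4`.
[cite: Zhang2022LandauSiegel, §17 u004 p.96] -/
theorem nuStar_bound (c' : ℝ) :
    ∃ C : ℝ, ForAllLarge fun _D _ χ => ∀ n : ℕ, ‖nuStar c' χ n‖ ≤ C * (n : ℝ) ^ (1 / 4 : ℝ) := by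
  obtain ⟨Cd, hCd1, hCd⟩ := Sieve.exists_card_divisors_le_mul_rpow' (by norm_num : (0 : ℝ) < 1 / 28)
  have hCd0 : 0 ≤ Cd := by linarith
  set Cb : ℝ := (1 + ‖iota2‖) * (‖iota3‖ + ‖iota4‖) with hCb
  have hCb0 : 0 ≤ Cb := by positivity
  refine ⟨Cd * (Cb * Cd) * Cd * Cd * Cd * 1 * Cd * 1 * Cd, ?_⟩
  obtain ⟨D₁, h1⟩ := exists_nat_forall_le_ell 2
  refine ⟨D₁, fun D _ χ hD _ _ n => ?_⟩
  have hℓ2 : 2 ≤ ell D := h1 D hD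
  have hℓ0 : 0 < ell D := by linarith
  -- the five factors, as power bounds with exponent `δ = 1/28` or `0`
  have hδ : (0 : ℝ) ≤ 1 / 28 := by norm_num
  have hK : ∀ m : ℕ, m ≠ 0 → ‖MeanSquareMajorant.kappa₂ (b1 c' D) m‖ ≤ Cd * (m : ℝ) ^ (1 / 28 : ℝ) :=
    fun m _ => (norm_kappa₂_le_card_divisors _ m).trans (hCd m)
  have hB : ∀ m : ℕ, m ≠ 0 → ‖bcoef D m * χ (m : ZMod D)‖ ≤ Cb * Cd * (m : ℝ) ^ (1 / 28 : ℝ) := by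
    intro m _
    rw [norm_mul]
    calc ‖bcoef D m‖ * ‖χ (m : ZMod D)‖ ≤ Cb * MeanSquareMajorant.tau 2 m * 1 :=
          mul_le_mul (norm_bcoef_le hℓ2 m) (χ.norm_le_one _) (norm_nonneg _)
            (mul_nonneg hCb0 (MeanSquareMajorant.tau_nonneg _ _))
      _ = Cb * (m.divisors.card : ℝ) := by rw [mul_one, MeanSquareMajorant.tau_two_apply]
      _ ≤ Cb * (Cd * (m : ℝ) ^ (1 / 28 : ℝ)) := mul_le_mul_of_nonneg_left (hCd m) hCb0
      _ = Cb * Cd * (m : ℝ) ^ (1 / 28 : ℝ) := by ring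
  have hU : ∀ m : ℕ, m ≠ 0 → ‖trunc (D ^ 4) (ups χ) m‖ ≤ Cd * (m : ℝ) ^ (1 / 28 : ℝ) := by
    intro m _
    have h1 : ‖trunc (D ^ 4) (ups χ) m‖ ≤ ‖ups χ m‖ := by
      rw [trunc]; split_ifs <;> simp
    refine h1.trans ((Lemma34.norm_ups_le χ m).trans ?_)
    rw [MeanSquareMajorant.tau_two_apply]; exact hCd m
  have hN2 : ∀ m : ℕ, m ≠ 0 → ‖nN D (beta2 c' D) m‖ ≤ 1 * (m : ℝ) ^ (0 : ℝ) := fun m _ => by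
    rw [Real.rpow_zero, mul_one]; exact norm_nN_le_one hℓ0 (Typed.Section13.beta2_re c' D) m
  have hN3 : ∀ m : ℕ, m ≠ 0 → ‖nN D (beta3 c' D) m‖ ≤ 1 * (m : ℝ) ^ (0 : ℝ) := fun m _ => by
    rw [Real.rpow_zero, mul_one]; exact norm_nN_le_one hℓ0 (Typed.Section13.beta3_re c' D) m
  -- four convolutions
  have c1 := norm_convolution_le_rpow hδ hδ hCd0 hK hB hCd
  have c2 := norm_convolution_le_rpow (by norm_num) hδ (by positivity) c1 hU hCd
  have c3 := norm_convolution_le_rpow (by norm_num) le_rfl (by positivity) c2 hN2 hCd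
  have c4 := norm_convolution_le_rpow (by norm_num) le_rfl (by positivity) c3 hN3 hCd
  rcases Nat.eq_zero_or_pos n with rfl | hn
  · rw [nuStar, LSeries.convolution_map_zero, norm_zero, Nat.cast_zero,
      Real.zero_rpow (by norm_num), mul_zero]
  · have := c4 n hn.ne'
    rw [nuStar]
    refine this.trans (le_of_eq ?_)
    norm_num

/-- **"By trivial estimation, the contribution from the terms with `m ≠ n` above is `o(p)`"
(§17 p. 96) is a THEOREM**: the typed inline claim `Claim17_offdiag c′` holds, for every `c′`
(via `claim17_offdiag_of_nuStar_bound` and `nuStar_bound`).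
[cite: Zhang2022LandauSiegel, §17 (17.3) p.96] -/
theorem claim17_offdiag_holds (c' : ℝ) : Claim17_offdiag c' :=
  claim17_offdiag_of_nuStar_bound (nuStar_bound c')

/-- **(17.3) from §17.u005 alone**: `Step17_u005 c′ → Eq17_3 c′` (the DAG node `Z22:(17.3)` reduces
to the term-by-term node `Z22:§17.u005`). [cite: Zhang2022LandauSiegel, §17 (17.3) p.96] -/
theorem eq17_3_of_u005 {c' : ℝ} (h5 : Step17_u005 c') : Eq17_3 c' :=
  eq17_3_of h5 (nuStar_bound c')

end NuStar

end Literature.NumberTheory.LFunctions.Zhang2022.Phi3Eval
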